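import Mathlib.RingTheory.MvPolynomial.Basic
import Mathlib.Algebra.MvPolynomial.Basic
import HarnessLib

/-!
# The coefficient identity of the suspension calibration (crux `FRationalResolution`, line `Sketch`)

Stub `stub_suspensionCoeff` (worker W3) of the skeleton `Sketch` for crux
stmt-ResolutionOfSingularities-15317, continuation seat c2 (the "suspension calibration": every
hyperbolic suspension `yz + f = 0` over `A = k[x]` lies in the residual class of the crux). Write
`A[y,z] = MvPolynomial (Fin 2) A` with `y = X 0`, `z = X 1`, and `g = yz + f`. Given the
characteristic-`p` expansion `g^(q-1) = Σ_{j<q} (−1)^j f^(q−1−j) yʲzʲ` (hypothesis `hexp`, the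
lead's `stub_suspension_pow_expand`), this file computes two coefficients of `c · g^(q−1)` for a
polynomial `c` all of whose exponents are `< q` in each variable:

* at `y^(q−1) z^(q−1−d)`: `(−1)^(q−1+d) f^d · Σ_{m ∈ supp c, m₀ − m₁ = d} (−1)^(m₁) c_m f^(m₁)`;
* at `y^(q−1−d) z^(q−1)`: `(−1)^(q−1) · Σ_{m ∈ supp c, m₀ − m₁ = −d} (−1)^(m₁) c_m f^(m₁)`.

Proof: expand `c = Σ_{m ∈ supp c} c_m yᵐ⁰zᵐ¹` (`MvPolynomial.as_sum`), multiply out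
(`monomial_mul`) and read off coefficients (`coeff_monomial`):
`coeff n (c · g^(q−1)) = Σ_m Σ_j [m + (j,j) = n] c_m (−1)^j f^(q−1−j)`
(`suspensionCoeff_coeff_mul_sum_monomial`). For `n = (q−1, q−1−d)` the condition `m + (j,j) = n`
pins `j = q−1−m₀` and forces `m₀ − m₁ = d` (`suspensionCoeff_key_iff_fst`), so the inner sum
collapses (`suspensionCoeff_inner_sum_collapse`) and the surviving term is rewritten with the parity
bookkeeping `(−1)^(q−1−m₀) = (−1)^(q−1+d) (−1)^(m₁)` (`suspensionCoeff_term_fst`); symmetrically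
for `n = (q−1−d, q−1)` with `j = q−1−m₁` (`suspensionCoeff_key_iff_snd`,
`suspensionCoeff_term_snd`).
Only Mathlib's `MvPolynomial` coefficient API is used; no facts.
-/

-- single-problem summit: the doubled namespace component is forced
set_option linter.dupNamespace false

namespace Summit.ResolutionOfSingularities.ResolutionOfSingularities.Theorems.FRationalResolution

open MvPolynomial
open scoped BigOperators

/-- Coefficients of a product with a sum of monomials: expanding `c = Σ_{m ∈ supp c} c_m Xᵐ`,
`coeff n (c · Σ_{j ∈ J} r_j X^(s j)) = Σ_{m ∈ supp c} Σ_{j ∈ J} [m + s j = n] c_m r_j`. -/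
theorem suspensionCoeff_coeff_mul_sum_monomial {σ R ι : Type*} [DecidableEq σ] [CommSemiring R]
    (c : MvPolynomial σ R) (J : Finset ι) (s : ι → σ →₀ ℕ) (r : ι → R) (n : σ →₀ ℕ) :
    coeff n (c * ∑ j ∈ J, monomial (s j) (r j)) =
      ∑ m ∈ c.support, ∑ j ∈ J, if m + s j = n then coeff m c * r j else 0 := by
  conv_lhs => rw [c.as_sum, Finset.sum_mul]
  rw [coeff_sum]
  refine Finset.sum_congr rfl fun m _ => ?_
  rw [Finset.mul_sum, coeff_sum]
  refine Finset.sum_congr rfl fun j _ => ?_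
  rw [monomial_mul, coeff_monomial]

/-- Exponent bookkeeping at `y^(q−1) z^(q−1−d)`: for `m₀, m₁ < q` and `d < q`,
`m + (j, j) = (q−1, q−1−d)` iff `m₀ − m₁ = d` (in `ℤ`) and `j = q − 1 − m₀`. -/
theorem suspensionCoeff_key_iff_fst (q d : ℕ) (hd : d < q) (m : Fin 2 →₀ ℕ)
    (hm : m 0 < q ∧ m 1 < q) (j : ℕ) :
    m + (Finsupp.single 0 j + Finsupp.single 1 j) =
        Finsupp.single 0 (q - 1) + Finsupp.single 1 (q - 1 - d) ↔
      ((m 0 : ℤ) - (m 1 : ℤ) = (d : ℤ)) ∧ j = q - 1 - m 0 := by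
  constructor
  · intro h
    have h0 := DFunLike.congr_fun h 0
    have h1 := DFunLike.congr_fun h 1
    simp at h0 h1
    omega
  · rintro ⟨hP, rfl⟩
    ext i
    fin_cases i <;> simp <;> omega

/-- Exponent bookkeeping at `y^(q−1−d) z^(q−1)`: for `m₀, m₁ < q` and `d < q`,
`m + (j, j) = (q−1−d, q−1)` iff `m₀ − m₁ = −d` (in `ℤ`) and `j = q − 1 − m₁`. -/
theorem suspensionCoeff_key_iff_snd (q d : ℕ) (hd : d < q) (m : Fin 2 →₀ ℕ)
    (hm : m 0 < q ∧ m 1 < q) (j : ℕ) :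
    m + (Finsupp.single 0 j + Finsupp.single 1 j) =
        Finsupp.single 0 (q - 1 - d) + Finsupp.single 1 (q - 1) ↔
      ((m 0 : ℤ) - (m 1 : ℤ) = -(d : ℤ)) ∧ j = q - 1 - m 1 := by
  constructor
  · intro h
    have h0 := DFunLike.congr_fun h 0
    have h1 := DFunLike.congr_fun h 1
    simp at h0 h1
    omega
  · rintro ⟨hP, rfl⟩
    ext i
    fin_cases i <;> simp <;> omega

/-- Collapse of the inner sum: if the exponent condition `m + (j, j) = n` is equivalent to
`P ∧ j = j₀` with `j₀ < q`, then `Σ_{j<q} [m + (j,j) = n] a r_j = [P] a r_{j₀}`. -/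
theorem suspensionCoeff_inner_sum_collapse {A : Type*} [CommRing A] (r : ℕ → A) (a : A) (q : ℕ)
    (m n : Fin 2 →₀ ℕ) (j₀ : ℕ) (hj₀ : j₀ < q) (P : Prop) [Decidable P]
    (hiff : ∀ j, m + (Finsupp.single 0 j + Finsupp.single 1 j) = n ↔ P ∧ j = j₀) :
    (∑ j ∈ Finset.range q,
        if m + (Finsupp.single 0 j + Finsupp.single 1 j) = n then a * r j else 0) =
      if P then a * r j₀ else 0 := by
  by_cases hP : P
  · simp_rw [hiff, if_pos hP]
    simp [hP, Finset.sum_ite_eq', hj₀]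
  · rw [if_neg hP]
    exact Finset.sum_eq_zero fun j _ => if_neg fun h => hP ((hiff j).mp h).1

/-- Parity bookkeeping of the surviving term at `y^(q−1) z^(q−1−d)`: with `j = q − 1 − m₀` and
`m₀ = m₁ + d < q`, `a · (−1)^j f^(q−1−j) = (−1)^(q−1+d) f^d · ((−1)^(m₁) a f^(m₁))`
(`(−1)^(q−1−m₀) = (−1)^(q−1+m₀)` and `m₀ = m₁ + d`). -/
theorem suspensionCoeff_term_fst {A : Type*} [CommRing A] (f a : A) (q d m0 m1 : ℕ) (hm0 : m0 < q)
    (hP : (m0 : ℤ) - (m1 : ℤ) = (d : ℤ)) :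
    a * ((-1) ^ (q - 1 - m0) * f ^ (q - 1 - (q - 1 - m0))) =
      (-1) ^ (q - 1 + d) * f ^ d * ((-1) ^ m1 * a * f ^ m1) := by
  obtain ⟨k, hk⟩ : ∃ k, q - 1 = k + m0 := ⟨q - 1 - m0, by omega⟩
  have hm : m0 = m1 + d := by omega
  rw [show q - 1 - m0 = k by omega, show q - 1 - k = m1 + d by omega,
    show q - 1 + d = k + m1 + d + d by omega]
  have h1 : ((-1 : A) ^ m1) * (-1) ^ m1 = 1 := by
    rw [← mul_pow, neg_mul_neg, one_mul, one_pow]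
  have h2 : ((-1 : A) ^ d) * (-1) ^ d = 1 := by
    rw [← mul_pow, neg_mul_neg, one_mul, one_pow]
  rw [show ((-1 : A)) ^ (k + m1 + d + d) * f ^ d * ((-1) ^ m1 * a * f ^ m1) =
      (-1) ^ k * (((-1 : A) ^ m1) * (-1) ^ m1) * (((-1 : A) ^ d) * (-1) ^ d) * (a * f ^ (m1 + d)) by
    ring, h1, h2]
  ring

/-- Parity bookkeeping of the surviving term at `y^(q−1−d) z^(q−1)`: with `j = q − 1 − m₁ `and
`m₁ < q`, `a · (−1)^j f^(q−1−j) = (−1)^(q−1) · ((−1)^(m₁) a f^(m₁))`. -/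
theorem suspensionCoeff_term_snd {A : Type*} [CommRing A] (f a : A) (q m1 : ℕ) (hm1 : m1 < q) :
    a * ((-1) ^ (q - 1 - m1) * f ^ (q - 1 - (q - 1 - m1))) =
      (-1) ^ (q - 1) * ((-1) ^ m1 * a * f ^ m1) := by
  obtain ⟨k, hk⟩ : ∃ k, q - 1 = k + m1 := ⟨q - 1 - m1, by omega⟩
  rw [show q - 1 - m1 = k by omega, show q - 1 - k = m1 by omega, hk]
  have h1 : ((-1 : A) ^ m1) * (-1) ^ m1 = 1 := by
    rw [← mul_pow, neg_mul_neg, one_mul, one_pow]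
  rw [show ((-1 : A)) ^ (k + m1) * ((-1) ^ m1 * a * f ^ m1) =
      (-1) ^ k * (((-1 : A) ^ m1) * (-1) ^ m1) * (a * f ^ m1) by ring, h1]
  ring

/-- **The coefficient identity of the suspension calibration** (registered stub
`stub_suspensionCoeff`, crux stmt-ResolutionOfSingularities-15317, line `Sketch`). In
`A[y,z] = MvPolynomial (Fin 2) A` (`y = X 0`, `z = X 1`) let `c` have all exponents `< q` in `y`
and in `z` (`hc`), let `d < q`, and assume the expansion
`(yz + f)^(q−1) = Σ_{j<q} (−1)^j f^(q−1−j) yʲzʲ` (`hexp`; it holds for `q = p^e` in characteristic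
`p`). Then the coefficient of `c · (yz + f)^(q−1)`

* at `y^(q−1) z^(q−1−d)` is `(−1)^(q−1+d) f^d · Σ_{m ∈ supp c, m₀ − m₁ = d} (−1)^(m₁) c_m f^(m₁)`,
  and
* at `y^(q−1−d) z^(q−1)` is `(−1)^(q−1) · Σ_{m ∈ supp c, m₀ − m₁ = −d} (−1)^(m₁) c_m f^(m₁)`:

a monomial `c_m yᵐ⁰zᵐ¹` times the `j`-th term contributes to `yᵁzⱽ` iff `m + (j,j) = (U,V)`, which
for `(U,V) = (q−1, q−1−d)` means `j = q−1−m₀`, `m₀ − m₁ = d` (all such `m ∈ supp c` occur since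
`m₀ < q`), with term `c_m (−1)^(q−1−m₀) f^(m₀) = (−1)^(q−1+d) f^d · (−1)^(m₁) c_m f^(m₁)`;
symmetrically for `(q−1−d, q−1)` with `j = q−1−m₁`. -/
theorem stub_suspensionCoeff (A : Type) [CommRing A] (f : A) (c : MvPolynomial (Fin 2) A)
    (q d : ℕ) (hd : d < q) (hc : ∀ m ∈ c.support, m 0 < q ∧ m 1 < q)
    (hexp : (MvPolynomial.X 0 * MvPolynomial.X 1 + MvPolynomial.C f : MvPolynomial (Fin 2) A) ^ (q - 1)
      = ∑ j ∈ Finset.range q, MvPolynomial.monomial (Finsupp.single 0 j + Finsupp.single 1 j)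
          ((-1) ^ j * f ^ (q - 1 - j))) :
    MvPolynomial.coeff (Finsupp.single 0 (q - 1) + Finsupp.single 1 (q - 1 - d))
        (c * (MvPolynomial.X 0 * MvPolynomial.X 1 + MvPolynomial.C f) ^ (q - 1)) =
      (-1) ^ (q - 1 + d) * f ^ d *
        (∑ m ∈ c.support with ((m 0 : ℤ) - (m 1 : ℤ) = (d : ℤ)),
          (-1) ^ (m 1) * MvPolynomial.coeff m c * f ^ (m 1)) ∧
    MvPolynomial.coeff (Finsupp.single 0 (q - 1 - d) + Finsupp.single 1 (q - 1))
        (c * (MvPolynomial.X 0 * MvPolynomial.X 1 + MvPolynomial.C f) ^ (q - 1)) =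
      (-1) ^ (q - 1) *
        (∑ m ∈ c.support with ((m 0 : ℤ) - (m 1 : ℤ) = -(d : ℤ)),
          (-1) ^ (m 1) * MvPolynomial.coeff m c * f ^ (m 1)) := by
  rw [hexp]
  constructor
  · -- the coefficient at `y^(q-1) z^(q-1-d)`
    rw [suspensionCoeff_coeff_mul_sum_monomial (ι := ℕ) c (Finset.range q)
      (fun j => Finsupp.single 0 j + Finsupp.single 1 j) (fun j => (-1) ^ j * f ^ (q - 1 - j))]
    have h1 : ∀ m ∈ c.support,
        (∑ j ∈ Finset.range q,
          if m + (Finsupp.single 0 j + Finsupp.single 1 j) =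
              Finsupp.single 0 (q - 1) + Finsupp.single 1 (q - 1 - d)
          then coeff m c * ((-1) ^ j * f ^ (q - 1 - j)) else 0) =
        if ((m 0 : ℤ) - (m 1 : ℤ) = (d : ℤ)) then
          (-1) ^ (q - 1 + d) * f ^ d * ((-1) ^ (m 1) * coeff m c * f ^ (m 1)) else 0 := by
      intro m hm
      rw [suspensionCoeff_inner_sum_collapse (fun j => (-1 : A) ^ j * f ^ (q - 1 - j)) (coeff m c) q
        m _ (q - 1 - m 0) (by omega) _ (suspensionCoeff_key_iff_fst q d hd m (hc m hm))]
      split_ifs with hP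
      · exact suspensionCoeff_term_fst f (coeff m c) q d (m 0) (m 1) (hc m hm).1 hP
      · rfl
    rw [Finset.sum_congr rfl h1, Finset.mul_sum, Finset.sum_filter]
  · -- the coefficient at `y^(q-1-d) z^(q-1)`
    rw [suspensionCoeff_coeff_mul_sum_monomial (ι := ℕ) c (Finset.range q)
      (fun j => Finsupp.single 0 j + Finsupp.single 1 j) (fun j => (-1) ^ j * f ^ (q - 1 - j))]
    have h1 : ∀ m ∈ c.support,
        (∑ j ∈ Finset.range q,
          if m + (Finsupp.single 0 j + Finsupp.single 1 j) =
              Finsupp.single 0 (q - 1 - d) + Finsupp.single 1 (q - 1)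
          then coeff m c * ((-1) ^ j * f ^ (q - 1 - j)) else 0) =
        if ((m 0 : ℤ) - (m 1 : ℤ) = -(d : ℤ)) then
          (-1) ^ (q - 1) * ((-1) ^ (m 1) * coeff m c * f ^ (m 1)) else 0 := by
      intro m hm
      rw [suspensionCoeff_inner_sum_collapse (fun j => (-1 : A) ^ j * f ^ (q - 1 - j)) (coeff m c) q
        m _ (q - 1 - m 1) (by omega) _ (suspensionCoeff_key_iff_snd q d hd m (hc m hm))]
      split_ifs with hP
      · exact suspensionCoeff_term_snd f (coeff m c) q (m 1) (hc m hm).2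
      · rfl
    rw [Finset.sum_congr rfl h1, Finset.mul_sum, Finset.sum_filter]

end Summit.ResolutionOfSingularities.ResolutionOfSingularities.Theorems.FRationalResolution
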